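import Summits.Langlands.Langlands.Theorems.IrreducibilityBySelfDualityGaloisRepOfRegularAlgebraicAEIrreducible
import Summits.Langlands.Langlands.Theorems.IrreducibilityBySelfDualityGaloisRepOfRegularAlgebraic
import HarnessLib

/-!
# `GaloisRepOfRegularAlgebraic` (item stmt-Langlands-10785): what the route actually consumes of it

Helper file (`--supports stmt-Langlands-10785`) recording, kernel-checked, a PLAN-LEVEL fact about the
crux `Summit.Langlands.Langlands.Theses.IrreducibilityBySelfDuality.GaloisRepOfRegularAlgebraic`
(lang.S27 verbatim: every `n`, `K` totally real or CM, compatibility at EVERY unramified `v ∤ ℓ`,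
`r` semisimple).  The route's deciding theorem `closes` hands the crux (`i2`) only to the landed
assembly, the assembly only to `IrreducibleGL3CM.frame_proof`, and `frame_proof` only to
`EssSelfDualIrreducibleCM_proof`, whose proof applies it exactly twice: at `n = 2` (to the adjoint-lift
datum `σ` over the CM field `K`) and at `n = 1` (to `ν`), discards semisimplicity, and uses the two
representations only through cofinite filters (`trace_identity`: Chebotarev density + continuity;
the dihedral exclusion: `filter_upwards [hdict, …]`).  Since `n = 1` is a theorem of the tree
(`GaloisRepOfRegularAlgebraic.rank_one`, Weil 1956), the route needs of lang.S27 only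

  `GL₂/CM/a.e.`: for `K` CM, `σ` regular algebraic cuspidal on `GL₂(𝔸_K)`, `ℓ`, `ι`, SOME continuous
  `ρ : Γ_K → GL₂(ℚ̄_ℓ)` unramified with `char(ρ(Frob_v)) = arithFrobPolyOfSatake ι q_v 2 β` for the
  Satake parameter `β` of `σ` at all but finitely many `v`

(written inline below; no definition is introduced).  This file proves:

* `essSelfDualIrreducibleCM_of_gl2CM_ae` — the TEXT of the route item `EssSelfDualIrreducibleCM`
  with its first antecedent (the crux, verbatim) replaced by `GL₂/CM/a.e.` (through
  `isIrreducible_of_compatible_ae` of the companion file `…AEIrreducible`);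
* `gl2CM_ae_of_item` — the crux as filed implies `GL₂/CM/a.e.` (so the replacement is a weakening);
* `gl2CM_ae_of_theoremA_existence` — `GL₂/CM/a.e.` follows from Harris–Lan–Taylor–Thorne's Thm. A
  (existence) ALONE (`theoremA_existence`, via `ae_of_theoremA_existence`): Varma's theorem
  (`Varma2024.prop71_twoN` / `theorem1_unramified_traces`, the line's stub S2) and every rank `n ≥ 3`
  leave the route's cone once the crux is restated in this shape.

The other two routes wanting the shared item do not consume it logically: in
`SteinbergVelocityDst.closes` it is the unused binder `_hGal`, and `CMFern.closes` does not take it.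

References: Harris–Lan–Taylor–Thorne, Res. Math. Sci. 3:37 (2016), Thm. A [HarrisLanTaylorThorneRMS2016];
I. Varma, Forum Math. Sigma 12 (2024) e21, Thm. 1 [VarmaFMS2024]; A. Weil (1956).
-/

noncomputable section

set_option linter.dupNamespace false -- project-wide option (lakefile weak.linter.dupNamespace); `Summit.Langlands.Langlands` is the mandated namespace (D-0017)

open scoped NumberField Classical
open Matrix Polynomial Filter IsDedekindDomain Field
open Literature.NumberTheory.Automorphic Literature.NumberTheory.GaloisRepresentations
open Literature.NumberTheory.Automorphic.HarrisLanTaylorThorne2016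
open Summit.Langlands.Langlands.Theorems.EssSelfDualIrreducibleCM

namespace Summit.Langlands.Langlands.Theorems.GaloisRepOfRegularAlgebraic

/-! ### The route item `EssSelfDualIrreducibleCM` from the `GL₂/CM/a.e.` form of the crux -/

/-- **`EssSelfDualIrreducibleCM` needs lang.S27 only for `GL₂` over CM fields, almost everywhere.**
The text of the route item `EssSelfDualIrreducibleCM` (stmt-Langlands-13618; by-name antecedent
`RegularAdjointLiftCM` replaced by its body, exactly as in `EssSelfDualIrreducibleCM_proof`) with its
FIRST antecedent — the crux `GaloisRepOfRegularAlgebraic` verbatim — replaced by the weaker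
`GL₂/CM/a.e.` statement: for `K` CM, `σ` regular algebraic cuspidal on `GL₂(𝔸_K)`, `ℓ`, `ι`, some
`ρ : Γ_K → GL₂(ℚ̄_ℓ)` unramified and Satake–Frobenius compatible with `σ` at almost every `v`.
Proof: `RegularAdjointLiftCM` gives `(σ, ν)`; `ρ₁` from the weakened antecedent; `ψ` from the tree's
THEOREM `rank_one` (Weil 1956); conclude by `isIrreducible_of_compatible_ae`. [folklore] -/
theorem essSelfDualIrreducibleCM_of_gl2CM_ae :
    (∀ (K : Type) [Field K] [NumberField K]
      (hcpt₂ : Literature.NumberTheory.Automorphic.isCompact_glFiniteIntegralLevel 2 K),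
      NumberField.IsCMField K →
      ∀ (σ : Literature.NumberTheory.Automorphic.CuspidalAutomorphicRepData 2 K hcpt₂),
      σ.1.IsRegularAlgebraic → ∀ (ℓ : ℕ) [Fact ℓ.Prime] (ι : PadicAlgCl ℓ ≃+* ℂ),
      ∃ ρ : Literature.NumberTheory.GaloisRepresentations.FramedGaloisRep K (PadicAlgCl ℓ) 2,
        ∀ᶠ v : IsDedekindDomain.HeightOneSpectrum (NumberField.RingOfIntegers K) in Filter.cofinite,
          ∀ β : Multiset ℂ, σ.1.HasSatakeParamAt v β →
            ρ.IsUnramifiedAt v ∧ ρ.HasFrobCharpolyAt v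
              (Literature.NumberTheory.Automorphic.arithFrobPolyOfSatake ι v.residueCard 2 β)) → (∀ (F :
      Type) [Field F] [NumberField F] (hF1 : _) (hF2 : _) (hF3 : _) (P :
      Literature.NumberTheory.Automorphic.CuspidalAutomorphicRepData 3 F hF3) (η :
      Literature.NumberTheory.Automorphic.CuspidalAutomorphicRepData 1 F hF1), (∀ᶠ v in cofinite, ∀
      α : Multiset ℂ, P.1.HasSatakeParamAt v α → ∃ e : ℂ, η.1.HasSatakeParamAt v {e} ∧ α.map (fun a
      => a⁻¹) = α.map (fun a => e * a)) → ∃ (π :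
      Literature.NumberTheory.Automorphic.CuspidalAutomorphicRepData 2 F hF2) (ν :
      Literature.NumberTheory.Automorphic.CuspidalAutomorphicRepData 1 F hF1), (∀ (L : Type) [Field
      L] [NumberField L] [Algebra F L], Module.finrank F L = 2 → ¬ (∀ᶠ v in cofinite, ∀ β : Multiset
      ℂ, π.1.HasSatakeParamAt v β → β.map (fun b => (if ∃ w : IsDedekindDomain.HeightOneSpectrum
      (NumberField.RingOfIntegers L), w.asIdeal.under (NumberField.RingOfIntegers F) = v.asIdeal ∧
      w.asIdeal.inertiaDeg (NumberField.RingOfIntegers F) = 1 then (1 : ℂ) else -1) * b) = β)) ∧ ∀ᶠ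
      v in cofinite, ∀ β : Multiset ℂ, π.1.HasSatakeParamAt v β → ∃ d e : ℂ, ν.1.HasSatakeParamAt v
      {d} ∧ η.1.HasSatakeParamAt v {e} ∧ d ^ 2 * e = 1 ∧ P.1.HasSatakeParamAt v ((((β ×ˢ β).map (fun
      p : ℂ × ℂ => p.1 * p.2⁻¹)).erase 1).map (fun c => d * c))) → ((∀ (F : Type) [Field F]
      [NumberField F] (hF1 : _) (hF2 : _) (hF3 : _) (P :
      Literature.NumberTheory.Automorphic.CuspidalAutomorphicRepData 3 F hF3) (η :
      Literature.NumberTheory.Automorphic.CuspidalAutomorphicRepData 1 F hF1), (∀ᶠ v in cofinite, ∀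
      α : Multiset ℂ, P.1.HasSatakeParamAt v α → ∃ e : ℂ, η.1.HasSatakeParamAt v {e} ∧ α.map (fun a
      => a⁻¹) = α.map (fun a => e * a)) → ∃ (π :
      Literature.NumberTheory.Automorphic.CuspidalAutomorphicRepData 2 F hF2) (ν :
      Literature.NumberTheory.Automorphic.CuspidalAutomorphicRepData 1 F hF1), (∀ (L : Type) [Field
      L] [NumberField L] [Algebra F L], Module.finrank F L = 2 → ¬ (∀ᶠ v in cofinite, ∀ β : Multiset
      ℂ, π.1.HasSatakeParamAt v β → β.map (fun b => (if ∃ w : IsDedekindDomain.HeightOneSpectrum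
      (NumberField.RingOfIntegers L), w.asIdeal.under (NumberField.RingOfIntegers F) = v.asIdeal ∧
      w.asIdeal.inertiaDeg (NumberField.RingOfIntegers F) = 1 then (1 : ℂ) else -1) * b) = β)) ∧ ∀ᶠ
      v in cofinite, ∀ β : Multiset ℂ, π.1.HasSatakeParamAt v β → ∃ d e : ℂ, ν.1.HasSatakeParamAt v
      {d} ∧ η.1.HasSatakeParamAt v {e} ∧ d ^ 2 * e = 1 ∧ P.1.HasSatakeParamAt v ((((β ×ˢ β).map (fun
      p : ℂ × ℂ => p.1 * p.2⁻¹)).erase 1).map (fun c => d * c))) → ∀ (K : Type) [Field K]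
      [NumberField K], NumberField.IsCMField K → ∀ (h1 : _) (hcpt₂ : _) (hcpt : _) (π :
      Literature.NumberTheory.Automorphic.CuspidalAutomorphicRepData 3 K hcpt),
      π.1.IsRegularAlgebraic → (∃ η : Literature.NumberTheory.Automorphic.CuspidalAutomorphicRepData
      1 K h1, ∀ᶠ v in cofinite, ∀ α : Multiset ℂ, π.1.HasSatakeParamAt v α → ∃ e : ℂ,
      η.1.HasSatakeParamAt v {e} ∧ α.map (fun a => a⁻¹) = α.map (fun a => e * a)) → ∃ (σ :
      Literature.NumberTheory.Automorphic.CuspidalAutomorphicRepData 2 K hcpt₂) (ν :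
      Literature.NumberTheory.Automorphic.CuspidalAutomorphicRepData 1 K h1), σ.1.IsRegularAlgebraic
      ∧ ν.1.IsRegularAlgebraic ∧ (∀ (L : Type) [Field L] [NumberField L] [Algebra K L],
      Module.finrank K L = 2 → ¬ (∀ᶠ v in cofinite, ∀ β : Multiset ℂ, σ.1.HasSatakeParamAt v β →
      β.map (fun b => (if ∃ w : IsDedekindDomain.HeightOneSpectrum (NumberField.RingOfIntegers L),
      w.asIdeal.under (NumberField.RingOfIntegers K) = v.asIdeal ∧ w.asIdeal.inertiaDeg
      (NumberField.RingOfIntegers K) = 1 then (1 : ℂ) else -1) * b) = β)) ∧ ∀ᶠ v in cofinite, ∀ α β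
      : Multiset ℂ, π.1.HasSatakeParamAt v α → σ.1.HasSatakeParamAt v β → ∃ d : ℂ,
      ν.1.HasSatakeParamAt v {d} ∧ α = (((β ×ˢ β).map (fun p : ℂ × ℂ => p.1 * p.2⁻¹)).erase 1).map
      (fun c => d * c)) → ∀ (K : Type) [Field K] [NumberField K], NumberField.IsCMField K → ∀ (h1 :
      _) (hcpt : _) (π : Literature.NumberTheory.Automorphic.CuspidalAutomorphicRepData 3 K hcpt),
      π.1.IsRegularAlgebraic → (∃ η : Literature.NumberTheory.Automorphic.CuspidalAutomorphicRepData
      1 K h1, ∀ᶠ v in cofinite, ∀ α : Multiset ℂ, π.1.HasSatakeParamAt v α → ∃ e : ℂ,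
      η.1.HasSatakeParamAt v {e} ∧ α.map (fun a => a⁻¹) = α.map (fun a => e * a)) → ∀ (ℓ : ℕ) [Fact
      ℓ.Prime] (ι : PadicAlgCl ℓ ≃+* ℂ) (r :
      Literature.NumberTheory.GaloisRepresentations.FramedGaloisRep K (PadicAlgCl ℓ) 3),
      r.toGaloisRep.IsSemisimple → (∀ᶠ v in cofinite, ∀ α : Multiset ℂ, π.1.HasSatakeParamAt v α →
      r.IsUnramifiedAt v ∧ r.HasFrobCharpolyAt v
      (Literature.NumberTheory.Automorphic.arithFrobPolyOfSatake ι v.residueCard 3 α)) → ¬ (∃ x :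
      Fin 3 → (Fin 3 → PadicAlgCl ℓ), LinearIndependent (PadicAlgCl ℓ) x ∧ ∀ (i : Fin 3) (g :
      Field.absoluteGaloisGroup K), ∃ c : PadicAlgCl ℓ, r.toGaloisRep g (x i) = c • x i) →
      r.toGaloisRep.IsIrreducible := by
  intro hGR hSD hRAL K _ _ hCM h1 hcpt π hRA hess ℓ _ ι r hrss hr h3
  have hcpt₂ : Literature.NumberTheory.Automorphic.isCompact_glFiniteIntegralLevel 2 K :=
    isCompact_glFiniteIntegralLevel_holds 2 K
  obtain ⟨σ, ν, hσRA, hνRA, hnd, hAd⟩ := hRAL hSD K hCM h1 hcpt₂ hcpt π hRA hess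
  obtain ⟨ρ₁, hρ₁⟩ := hGR K hcpt₂ hCM σ hσRA ℓ ι
  -- `n = 1` is a THEOREM of the tree (Weil 1956): `GaloisRepOfRegularAlgebraic.rank_one`
  obtain ⟨ψ, -, hψ⟩ := rank_one K h1 ν hνRA ℓ ι
  have hψ' : ∀ᶠ v : HeightOneSpectrum (𝓞 K) in cofinite, ∀ γ : Multiset ℂ, ν.1.HasSatakeParamAt v γ →
      ψ.IsUnramifiedAt v ∧ ψ.HasFrobCharpolyAt v (arithFrobPolyOfSatake ι v.residueCard 1 γ) := by
    filter_upwards [FramedGaloisRep.eventually_natCast_not_mem K ℓ] with v hℓ γ hγ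
    exact hψ v γ hγ hℓ
  exact isIrreducible_of_compatible_ae ι π σ ν hnd hAd ρ₁ hρ₁ ψ hψ' r hrss hr h3


/-! ### The `GL₂/CM/a.e.` form is implied by the crux as filed, and by Thm. A (existence) alone -/

/-- The crux as filed (lang.S27 verbatim: every `n`, every unramified `v ∤ ℓ`, semisimple) implies its
`GL₂/CM/a.e.` form (specialise `n = 2`, forget semisimplicity, and discard the finitely many places
over `ℓ`, `FramedGaloisRep.eventually_natCast_not_mem`). [folklore] -/
theorem gl2CM_ae_of_item :
    (∀ (n : ℕ) (K : Type) [Field K] [NumberField K] (hcpt :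
      Literature.NumberTheory.Automorphic.isCompact_glFiniteIntegralLevel n K),
      (NumberField.IsTotallyReal K ∨ NumberField.IsCMField K) → ∀ (π :
      Literature.NumberTheory.Automorphic.CuspidalAutomorphicRepData n K hcpt),
      π.1.IsRegularAlgebraic → ∀ (ℓ : ℕ) [Fact ℓ.Prime] (ι : PadicAlgCl ℓ ≃+* ℂ), ∃ r :
      Literature.NumberTheory.GaloisRepresentations.FramedGaloisRep K (PadicAlgCl ℓ) n,
      r.toGaloisRep.IsSemisimple ∧ ∀ (v : IsDedekindDomain.HeightOneSpectrum
      (NumberField.RingOfIntegers K)) (α : Multiset ℂ), π.1.HasSatakeParamAt v α → ((ℓ : ℕ) :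
      NumberField.RingOfIntegers K) ∉ v.asIdeal → r.IsUnramifiedAt v ∧ r.HasFrobCharpolyAt v
      (Literature.NumberTheory.Automorphic.arithFrobPolyOfSatake ι v.residueCard n α)) →
    (∀ (K : Type) [Field K] [NumberField K]
      (hcpt₂ : Literature.NumberTheory.Automorphic.isCompact_glFiniteIntegralLevel 2 K),
      NumberField.IsCMField K →
      ∀ (σ : Literature.NumberTheory.Automorphic.CuspidalAutomorphicRepData 2 K hcpt₂),
      σ.1.IsRegularAlgebraic → ∀ (ℓ : ℕ) [Fact ℓ.Prime] (ι : PadicAlgCl ℓ ≃+* ℂ),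
      ∃ ρ : Literature.NumberTheory.GaloisRepresentations.FramedGaloisRep K (PadicAlgCl ℓ) 2,
        ∀ᶠ v : IsDedekindDomain.HeightOneSpectrum (NumberField.RingOfIntegers K) in Filter.cofinite,
          ∀ β : Multiset ℂ, σ.1.HasSatakeParamAt v β →
            ρ.IsUnramifiedAt v ∧ ρ.HasFrobCharpolyAt v
              (Literature.NumberTheory.Automorphic.arithFrobPolyOfSatake ι v.residueCard 2 β)) := by
  intro h K _ _ hcpt₂ hCM σ hσ ℓ _ ι
  obtain ⟨ρ, -, hρ⟩ := h 2 K hcpt₂ (Or.inr hCM) σ hσ ℓ ι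
  refine ⟨ρ, ?_⟩
  filter_upwards [FramedGaloisRep.eventually_natCast_not_mem K ℓ] with v hℓ β hβ
  exact hρ v β hβ hℓ

/-- The `GL₂/CM/a.e.` form of the crux follows from Harris–Lan–Taylor–Thorne's **Theorem A
(existence)** alone (`theoremA_existence`, through the landed `ae_of_theoremA_existence` at `n = 2`):
no appeal to Varma's local–global compatibility at every unramified place.
[cite: HarrisLanTaylorThorneRMS2016, Thm. A (p. 3)] -/
theorem gl2CM_ae_of_theoremA_existence :
    theoremA_existence → (∀ (K : Type) [Field K] [NumberField K]
      (hcpt₂ : Literature.NumberTheory.Automorphic.isCompact_glFiniteIntegralLevel 2 K),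
      NumberField.IsCMField K →
      ∀ (σ : Literature.NumberTheory.Automorphic.CuspidalAutomorphicRepData 2 K hcpt₂),
      σ.1.IsRegularAlgebraic → ∀ (ℓ : ℕ) [Fact ℓ.Prime] (ι : PadicAlgCl ℓ ≃+* ℂ),
      ∃ ρ : Literature.NumberTheory.GaloisRepresentations.FramedGaloisRep K (PadicAlgCl ℓ) 2,
        ∀ᶠ v : IsDedekindDomain.HeightOneSpectrum (NumberField.RingOfIntegers K) in Filter.cofinite,
          ∀ β : Multiset ℂ, σ.1.HasSatakeParamAt v β →
            ρ.IsUnramifiedAt v ∧ ρ.HasFrobCharpolyAt v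
              (Literature.NumberTheory.Automorphic.arithFrobPolyOfSatake ι v.residueCard 2 β)) := by
  intro hA K _ _ hcpt₂ hCM σ hσ ℓ _ ι
  obtain ⟨ρ, -, hρ⟩ := ae_of_theoremA_existence hA 2 K hcpt₂ (Or.inr hCM) σ hσ ℓ ι
  exact ⟨ρ, hρ⟩

end Summit.Langlands.Langlands.Theorems.GaloisRepOfRegularAlgebraic

end
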